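import Summits.CriticalPhenomena.PercolationContinuityZ3.Theses.PercNearOneGluing
import Literature.Probability.Percolation.PercolationEvents
import HarnessLib.Audit

/-! TTRL-lite variant V2430 of stmt-CriticalPhenomena-4574

(`stub_shorteningStep` of line `kn_shortening_induction`, move `specialise+small_case`:
`n := 3` and `A.card = 4`).  The side condition is contradictory on its own: a finset
`A : Finset (Fin 3)` has `A.card ≤ Fintype.card (Fin 3) = 3 < 4`.  So the statement holds
vacuously (compare the sibling variant V2523, `n ≤ 3 ∧ A.card = 3`).  No new definitions,
no named facts, the induction hypothesis is not used. -/

namespace Summit.CriticalPhenomena.PercolationContinuityZ3.Theorems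

open MeasureTheory Set Literature.Probability.LatticeModels Literature.Probability.Percolation
open scoped Classical BigOperators

/-- TTRL-lite variant V2430 of `stub_shorteningStep` (stmt-CriticalPhenomena-4574, Kozma–Nitzan
shortening step with the induction hypothesis displayed): the inequality
`μ(⋃ a ∈ A, v ↔ a) · μ(a₀ ↔ b) ≤ μ(v ↔ b)` for the glued measure `μ = prodBernoulli (w[s(v,x) ↦ 1])`
on `Fin 3` in the (empty) case `A.card = 4`.  Vacuous: `A.card ≤ Fintype.card (Fin 3) = 3`. -/
theorem stub_shorteningStep_var2430 : ∀ (w : Sym2 (Fin 3) → unitInterval) (A : Finset (Fin 3)) (b v x a₀ : Fin 3), A.card = 4 → v ∉ A → v ≠ x → w s(v, x) = 0 → a₀ ∈ A → (∀ a ∈ A, (prodBernoulli w).real (openConn a₀ b) ≤ (prodBernoulli w).real (openConn a b)) → (∀ w' : Sym2 (Fin 3) → unitInterval, (∀ e, w e = 0 → w' e = 0) → ∀ (A' : Finset (Fin 3)) (o' b' : Fin 3) (t : ℝ), (∀ a ∈ A', t ≤ (prodBernoulli w').real (openConn a b')) → (prodBernoulli w').real (⋃ a ∈ A', openConn o' a)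 * t ≤ (prodBernoulli w').real (openConn o' b')) → (prodBernoulli (Function.update w s(v, x) 1)).real (⋃ a ∈ A, openConn v a) * (prodBernoulli (Function.update w s(v, x) 1)).real (openConn a₀ b) ≤ (prodBernoulli (Function.update w s(v, x) 1)).real (openConn v b) := by
  intro w A b v x a₀ hcard
  -- `A ⊆ Fin 3` has at most `3` elements, never `4`: contradiction
  have hle : A.card ≤ Fintype.card (Fin 3) := Finset.card_le_univ A
  rw [Fintype.card_fin] at hle
  omega

end Summit.CriticalPhenomena.PercolationContinuityZ3.Theorems
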